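import Literature.AnabelianGeometry.EtaleTheta.ThetaCoversAxioms
import Literature.AnabelianGeometry.SemiGraphs.TemperedAnabelian
import Mathlib.Topology.Algebra.ContinuousMonoidHom
import Mathlib.GroupTheory.DoubleCoset
import Mathlib.GroupTheory.SpecificGroups.Dihedral
import Mathlib.Topology.Algebra.Category.ProfiniteGrp.Completion
import Mathlib.GroupTheory.FreeGroup.IsFreeGroup

/-!
# The tempered tower of theta coverings ([EtTh] §2: Prop 2.4, Def 2.5, Rmk 2.5.1, Prop 2.6,
# Rmk 2.6.1, Cor 2.9, Rmk 2.9.1, Lem 2.17 (i)(ii), Rmk 2.16.2–3; Def 2.7 deferred)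

Mochizuki, *The Étale Theta Function …* [EtTh], Publ. RIMS 45 (2009), §2, PRIMS text pp.38–43
(locators `p.N` = PDF pages; bib key `MochizukiEtTh2009`). "Now, we return to the discussion of
§1. In particular, we assume that `K` is a finite extension of `ℚ_p`" (p.39).

Over `ThetaCovers.CoverData` (profinite side, Def 2.1–2.3) we add the TEMPERED fundamental group
`Π^tp_C` with its dense embedding into `Π_C` ([SemiAnbd] Prop 3.6), the `Z`-covering `Y → X` of
§1 (`Π^tp_X ↠ Z`, p.12), `Ÿ` (p.17) and the double covering `Ċ → C` of Def 1.7 — all owned by seat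
abc-iut-L2-t1 (`EtaleTheta.ThetaSetting`, Def 1.7 file); interface `ThetaCovers.TemperedCoverData`,
TODO-merge(abc-iut-L2-t1). Tempered fundamental groups of the finite coverings of §2 are the
inverse images of the profinite ones. Typing conventions: "any isomorphism `γ : Π^tp_{Z_α} ≃
Π^tp_{Z_β}` induces isomorphisms compatible with the natural maps between the respective `Π^tp`'s
of the tower" (Props 2.4, 2.6) is typed in the ONE-OBJECT form (`α = β`) ONLY — every automorphism
of the topological group `Π^tp_Z` extends to an automorphism of `Π^tp_C` stabilising every member of the
printed list; the isomorphism-between-different-curves content of the print is not typed here.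
`Aut_K(−)` of a member `Z` (Rmk 2.6.1) is `N_{Π^tp_C}(Π^tp_Z)/Π^tp_Z` (`C` is a `K`-core).
v2 (interface repair, plan/GAP-LEDGER G-L2d3-5, additive): ONE new field `TemperedCoverData.isOpen_PiCuu'`
("`Π_{C̲̲}` is open in `Π_C`", Def 2.3) — the openness of the finite coverings of the tower is to be
derived from it and no longer from `CoverData.isOpen_barKer`, which forces `G_K` to be finite
(`TemperedCoverData.finite_GK`, `Discharge/Sec2TemperedCoverDataFiniteGK.lean`); all other
declarations are byte-identical to v1.

Not here (need the étale theta class `η̈^Θ`, "standard type" (Def 1.9) and the `{±1}`-structure of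
Thm 1.10 (iii), all abc-iut-L2-t1): Def 2.7, Cor 2.8, Rmk 2.9.2; the LABEL MAP of Cor 2.9 (labels
of irreducible components of the special fibre of `Y`, p.42) — Cor 2.9 is typed as the statement
that the `Aut_K`-orbits of cusps have the cardinality of `(ℤ/lℤ)^±`, the labelling itself being
TODO-merge(abc-iut-L2-t1/L3-t2). Def 2.5 (i)'s second condition ("compatible with the
`{±1}`-structure of Theorem 1.10 (iii)") is an explicit predicate parameter of the Def 2.5 decls.
-/

namespace Literature.AnabelianGeometry.EtaleTheta

namespace ThetaCovers

universe u

/-- **Interface (p.39–40, Def 2.5)**: the profinite cover data of Def 2.1–2.3 together with a CHOSEN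
`C̲̲` of type `(1, l-torsΘ)±` (field `PiCuu`), the tempered fundamental group `Π^tp_C` densely
embedded in `Π_C`, the coverings `Y` ("the natural quotient `Π^tp_X ↠ Z` discussed at the
beginning of §1", p.39), `Ÿ` (p.40 "the covering `Ÿ^log → C^log`") and `Ċ` (Def 1.7; p.39 "the
covering `Ċ^log → C^log`"). The `{±1}`-compatibility condition of Def 2.5 (i) (Thm 1.10 (iii), a
§1 notion of abc-iut-L2-t1) enters the Def 2.5 predicates as an explicit predicate PARAMETER on the
subgroup `Π_{X̲̲}` (no free `Prop` field). TODO-merge(abc-iut-L2-t1).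
[cite: MochizukiEtTh2009, Def 2.5 p.39] -/
structure TemperedCoverData (l : ℕ) extends CoverDataAx.{u} l where
  /-- `Π_C̲̲ ⊆ Π_C`, a chosen orbicurve of type `(1, l-torsΘ)±` (Def 2.3) -/
  PiCuu : Subgroup PiC
  /-- it is of type `(1, l-torsΘ)±` -/
  isTypeLTorsThetaPm : toCoverData.IsTypeLTorsThetaPm PiCuu
  /-- `Π_{C̲̲}` is open in `Π_C`: `C̲̲^log` is a finite étale covering of `C^log` ("a smooth log orbicurve
  over `K` that arises … as `C̲̲^log`", Def 2.3, p.38), so `Π_{C̲̲} ⊆ Π_C` is an open subgroup of finite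
  index. (v2: this datum replaces the use of `CoverData.isOpen_barKer`, which — `Π_C` being compact —
  forces `G_K` to be finite, `Discharge/Sec2TemperedCoverDataFiniteGK.lean`; primed field name, the API
  lemma is `TemperedCoverData.isOpen_PiCuu` of `Discharge/Sec2Prop24Reduction.lean`.) -/
  isOpen_PiCuu' : IsOpen (PiCuu : Set PiC)
  /-- `Π^tp_C`, the tempered fundamental group of `C^log` (p.38) -/
  Gtp : Type u
  [grpTp : Group Gtp]
  [topTp : TopologicalSpace Gtp]
  [tgTp : IsTopologicalGroup Gtp]
  /-- `Π^tp_C → Π_C`, the map to the profinite completion ([SemiAnbd] Prop 3.6) -/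
  toHat : Gtp →* PiC
  /-- it is continuous … -/
  continuous_toHat : Continuous toHat
  /-- … injective ([SemiAnbd] Prop 3.6 (iii)) … -/
  injective_toHat : Function.Injective toHat
  /-- … and exhibits `Π_C` as THE profinite completion of `Π^tp_C` (L3's frozen predicate
  `SemiGraphs.IsProfiniteCompletion`: compact Hausdorff totally disconnected target, dense range,
  every open normal finite-index subgroup is a pull-back; L2-lead ruling 19:56Z) -/
  isProfiniteCompletion_toHat :
    Literature.AnabelianGeometry.SemiGraphs.IsProfiniteCompletion ⟨toHat, continuous_toHat⟩
  /-- `Π^tp_Y ⊆ Π^tp_C`: the kernel of "the natural quotient `Π^tp_X ↠ Z`" (p.12, p.39) -/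
  PiYtp : Subgroup Gtp
  /-- `Π^tp_Y ⊆ Π^tp_X` -/
  PiYtp_le : PiYtp ≤ PiX.comap toHat
  /-- `Y → C` is Galois (`Gal(Y/C)`, p.46) -/
  PiYtp_normal : PiYtp.Normal
  /-- `Π^tp_Y` is open -/
  isOpen_PiYtp : IsOpen (PiYtp : Set Gtp)
  /-- `Π^tp_X/Π^tp_Y = Z ≅ ℤ` (p.12) -/
  quotZ : Nonempty (↥(PiX.comap toHat) ⧸ PiYtp.subgroupOf (PiX.comap toHat) ≃* Multiplicative ℤ)
  /-- `Π^tp_Ÿ ⊆ Π^tp_Y` (`Ÿ = Y₂`, p.17; p.40) -/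
  PiYddtp : Subgroup Gtp
  /-- `Π^tp_Ÿ ⊆ Π^tp_Y` … -/
  PiYddtp_le : PiYddtp ≤ PiYtp
  /-- … open … -/
  isOpen_PiYddtp : IsOpen (PiYddtp : Set Gtp)
  /-- … of index `2` in `Π^tp_Y` -/
  relIndex_PiYddtp : PiYddtp.relIndex PiYtp = 2
  /-- `Π^tp_Ċ ⊆ Π^tp_C`, the double covering `Ċ^log → C^log` of Def 1.7 (type `(1, μ₂)±`) -/
  PiCdot : Subgroup Gtp
  /-- `[Π^tp_C : Π^tp_Ċ] = 2` -/
  index_PiCdot : PiCdot.index = 2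
  /-- `Π^tp_Ċ` is open -/
  isOpen_PiCdot : IsOpen (PiCdot : Set Gtp)
  /-- `Ċ ≠ X` as coverings of `C` -/
  PiCdot_ne : PiCdot ≠ PiX.comap toHat

attribute [instance] TemperedCoverData.grpTp TemperedCoverData.topTp TemperedCoverData.tgTp

namespace TemperedCoverData

variable {l : ℕ} (T : TemperedCoverData.{u} l)

/-- `Π_X̲̲ = Π_C̲̲ ∩ Π_X` (Prop 2.2 (iii), cartesian square). [cite: MochizukiEtTh2009, Def 2.3 p.38] -/
def PiXuu : Subgroup T.PiC := T.PiCuu ⊓ T.PiX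

/-- `Π_X̲ = Π_X̲̲ · Δ̄_Θ` (Prop 2.2 (ii): `Δ̄_X̲ = Δ̄_X̲̲ · Δ̄_Θ`). [cite: MochizukiEtTh2009, Def 2.1 p.36] -/
def PiXu : Subgroup T.PiC := T.PiXuu ⊔ T.barTheta

/-- `Π_C̲ = Π_C̲̲ · Δ̄_Θ`. [cite: MochizukiEtTh2009, Def 2.1 p.36] -/
def PiCu : Subgroup T.PiC := T.PiCuu ⊔ T.barTheta

/-- The tempered fundamental group of a finite covering: inverse image of the profinite one.
[cite: MochizukiEtTh2009, Prop 2.4 p.38] -/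
def tp (H : Subgroup T.PiC) : Subgroup T.Gtp := H.comap T.toHat

/-- The undotted tower of Prop 2.4: `Π^tp` of `X̲̲, X̲, X, C̲̲, C̲, Ÿ` inside `Π^tp_C` (`C` itself is the
whole group; `Y` is NOT in the printed lists and is not included — review of p406952).
[cite: MochizukiEtTh2009, Prop 2.4 p.38] -/
def tower : List (Subgroup T.Gtp) :=
  [T.tp T.PiXuu, T.tp T.PiXu, T.tp T.PiX, T.tp T.PiCuu, T.tp T.PiCu, T.PiYddtp]

/-- The dotted tower (Def 2.5 (ii)): `Π^tp_{Ẋ̲̲} = Π^tp_{X̲̲} ∩ Π^tp_Ċ`, …, `Π^tp_Ċ` ("the composite of the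
covering … of `C^log` with the covering `Ċ^log → C^log`"). [cite: MochizukiEtTh2009, Def 2.5(ii) p.39] -/
def dottedTower : List (Subgroup T.Gtp) :=
  [T.tp T.PiXuu ⊓ T.PiCdot, T.tp T.PiXu ⊓ T.PiCdot, T.tp T.PiCuu ⊓ T.PiCdot,
    T.tp T.PiCu ⊓ T.PiCdot, T.PiCdot]

/-- "`γ` induces isomorphisms compatible with the various natural maps between the respective `Π^tp`'s"
(Props 2.4, 2.6), one-object form: `γ ∈ Aut(H)` EXTENDS to an automorphism of `Π^tp_C` stabilising
every member of the list `L` (existence only, as printed: "induces"; uniqueness — true in the model by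
slimness — is not asserted). [cite: MochizukiEtTh2009, Prop 2.4 p.38] -/
def ExtendsStabilising (H : Subgroup T.Gtp) (γ : H ≃ₜ* H) (L : List (Subgroup T.Gtp)) : Prop :=
  ∃ Γ : T.Gtp ≃ₜ* T.Gtp, (∀ h : H, Γ h = γ h) ∧ ∀ S ∈ L, S.map Γ.toMulEquiv.toMonoidHom = S

/-- **Proposition 2.4** (Characteristic Nature of Coverings; `K/ℚ_p` finite, `l` odd, `X̲̲` with
stable reduction and singular split special fibre): any automorphism of the topological group
`Π^tp_{X̲̲}` (resp. `Π^tp_{X̲}`; `Π^tp_{C̲̲}`; `Π^tp_{C̲}`) extends to `Π^tp_C` stabilising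
`Π^tp` of `X̲̲, X̲, X, C̲̲, C̲, C, Ÿ` (resp. of `X̲, X, C, Ÿ`; of `C̲̲, C̲, C, X̲̲, X̲, X, Ÿ`; of `C̲, C, X̲, X, Ÿ`)
— the printed per-case lists (kurims p.35). The printed standing hypotheses (`K/ℚ_p` finite; `X̲̲` has
stable reduction over `O_K` with singular, split special fibre; Def 2.5) are SETTING data
(TODO-merge(abc-iut-L2-t1): fields of the §1 setting), not fields of this interface.
[cite: MochizukiEtTh2009, Prop 2.4 p.38] -/
def Prop24 : Prop :=
  (∀ γ : ↥(T.tp T.PiXuu) ≃ₜ* ↥(T.tp T.PiXuu), T.ExtendsStabilising _ γ T.tower) ∧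
  (∀ γ : ↥(T.tp T.PiXu) ≃ₜ* ↥(T.tp T.PiXu),
    T.ExtendsStabilising _ γ [T.tp T.PiXu, T.tp T.PiX, T.PiYddtp]) ∧
  (∀ γ : ↥(T.tp T.PiCuu) ≃ₜ* ↥(T.tp T.PiCuu), T.ExtendsStabilising _ γ T.tower) ∧
  (∀ γ : ↥(T.tp T.PiCu) ≃ₜ* ↥(T.tp T.PiCu),
    T.ExtendsStabilising _ γ [T.tp T.PiCu, T.tp T.PiXu, T.tp T.PiX, T.PiYddtp])

/-! ## Definition 2.5 -/

/-- **Definition 2.5 (i), the conditions**: (a) "the quotient `Π̄_X ↠ Q` factors through the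
natural quotient `Π^tp_X ↠ Z`" — `Π^tp_Y ⊆ Π^tp_{X̲}`; (b) the splitting of `D_x ↠ G_K` defining
`X̲̲ → X̲` "is compatible with the `{±1}`-structure of Theorem 1.10, (iii)" — the predicate
`IsPmCompatible` on `Π_{X̲̲}` (parameter; abc-iut-L2-t1's Thm 1.10 (iii) notion, TODO-merge). The
printed standing hypotheses "`l` and the residue characteristic of `K` odd, `K = K̈`" (`√q_X ∈ K`, so
`Ÿ → X` is Galois over `K`) are carried by the SETTING (abc-iut-L2-t1), not by this predicate.
[cite: MochizukiEtTh2009, Def 2.5(i) p.39] -/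
def Def25Conditions (IsPmCompatible : Subgroup T.PiC → Prop) : Prop :=
  T.PiYtp ≤ T.tp T.PiXu ∧ IsPmCompatible T.PiXuu

/-- **Definition 2.5 (i)**: under `Def25Conditions`, `X̲` (resp. `X̲̲`; `C̲`; `C̲̲`) is said to be of
type `(1, ℤ/lℤ)` (resp. `(1, (ℤ/lℤ)^Θ)`; `(1, ℤ/lℤ)±`; `(1, (ℤ/lℤ)^Θ)±`) — as a predicate on open
subgroups of `Π^tp_C` up to conjugacy, indexed by `i = 0,1,2,3` in that order.
[cite: MochizukiEtTh2009, Def 2.5(i) p.39] -/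
def OfTypeZMod (IsPmCompatible : Subgroup T.PiC → Prop) (i : Fin 4) (H : Subgroup T.Gtp) : Prop :=
  T.Def25Conditions IsPmCompatible ∧ ∃ c : T.Gtp,
    H.map (MulAut.conj c).toMonoidHom = [T.tp T.PiXu, T.tp T.PiXuu, T.tp T.PiCu, T.tp T.PiCuu].get i

/-- **Definition 2.5 (ii)**: the composites `Ẋ̲, Ẋ̲̲, Ċ̲, Ċ̲̲` with `Ċ → C` are of type
`(1, μ₂ × ℤ/lℤ)` (resp. `(1, μ₂ × (ℤ/lℤ)^Θ)`; `(1, μ₂ × ℤ/lℤ)±`; `(1, μ₂ × (ℤ/lℤ)^Θ)±`).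
[cite: MochizukiEtTh2009, Def 2.5(ii) p.39] -/
def OfTypeMu2ZMod (IsPmCompatible : Subgroup T.PiC → Prop) (i : Fin 4) (H : Subgroup T.Gtp) :
    Prop :=
  T.Def25Conditions IsPmCompatible ∧ ∃ c : T.Gtp, H.map (MulAut.conj c).toMonoidHom =
    [T.tp T.PiXu ⊓ T.PiCdot, T.tp T.PiXuu ⊓ T.PiCdot, T.tp T.PiCu ⊓ T.PiCdot,
      T.tp T.PiCuu ⊓ T.PiCdot].get i

/-! ### Remark 2.5.1 (p.40): "the irreducible components of the special fiber of `C̲`, `Ċ̲` may be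
naturally identified with the elements of `(ℤ/lℤ)/{±1}`" — special-fibre statement, cf. Cor 2.9;
no decl (dual-graph data are on the L3 side). -/

/-- **Proposition 2.6** (Characteristic Nature of Coverings, dotted case): any automorphism of
`Π^tp_{Ẋ̲̲}` (resp. `Π^tp_{Ẋ̲}`; `Π^tp_{Ċ̲̲}`; `Π^tp_{Ċ̲}`) extends to `Π^tp_C` compatibly with the
`Π^tp`'s "of `X̲̲` (resp. `X̲`; `C̲̲`; `C̲`) and `Ċ`" — i.e. stabilising the undotted curve and `Π^tp_Ċ`.
[cite: MochizukiEtTh2009, Prop 2.6 p.40] -/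
def Prop26 : Prop :=
  ∀ Z ∈ [T.tp T.PiXuu, T.tp T.PiXu, T.tp T.PiCuu, T.tp T.PiCu],
    ∀ γ : ↥(Z ⊓ T.PiCdot) ≃ₜ* ↥(Z ⊓ T.PiCdot), T.ExtendsStabilising _ γ [Z ⊓ T.PiCdot, Z, T.PiCdot]

/-- **Proposition 2.6, last sentence**: "A similar statement holds when `Π^tp` is replaced by `Π`"
(profinite fundamental groups): automorphisms of the profinite `Π_{Z}` of a dotted member extend
to `Π_C` stabilising the closures (existence only, as printed).
[cite: MochizukiEtTh2009, Prop 2.6 p.40] -/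
def Prop26_profinite : Prop :=
  ∀ Z ∈ [T.tp T.PiXuu, T.tp T.PiXu, T.tp T.PiCuu, T.tp T.PiCu],
    ∀ γ : ((Z ⊓ T.PiCdot).map T.toHat).topologicalClosure ≃ₜ*
        ((Z ⊓ T.PiCdot).map T.toHat).topologicalClosure,
    ∃ Γ : T.PiC ≃ₜ* T.PiC, (∀ h : ((Z ⊓ T.PiCdot).map T.toHat).topologicalClosure, Γ h = γ h) ∧
      ∀ S ∈ [Z ⊓ T.PiCdot, Z, T.PiCdot],
        ((S.map T.toHat).topologicalClosure).map Γ.toMulEquiv.toMonoidHom =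
          (S.map T.toHat).topologicalClosure

/-- `Aut_K(Z) ≅ N_{Π^tp_C}(Π^tp_Z)/Π^tp_Z` for a member `Z` of the tower (`C` is a `K`-core, so every
`K`-automorphism lies over `C`): the normaliser quotient. [cite: MochizukiEtTh2009, Rmk 2.6.1 p.40] -/
abbrev autK (S : Subgroup T.Gtp) : Type u :=
  ↥(Subgroup.normalizer (S : Set T.Gtp)) ⧸ S.subgroupOf (Subgroup.normalizer (S : Set T.Gtp))

/-- "`K` contains a primitive `l`-th root of unity" (hypothesis of Rmk 2.6.1 / Cor 2.9), group-
theoretically: `G_K` — hence all of `Π_C`, as `Δ_X` acts trivially and the inversion by `+1` — acts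
trivially on `Δ̄_Θ ≅ (ℤ/lℤ)(1)`. [cite: MochizukiEtTh2009, Rmk 2.6.1 p.40] -/
def HasMuL : Prop := ∀ c : T.PiC, ∀ t ∈ T.barTheta, c * t * c⁻¹ * t⁻¹ ∈ T.barKer

/-- **Remark 2.6.1** (`K ⊇ μ_l`): "`Aut_K(X̲̲^log) = μ_l × {±1}`; `Aut_K(X̲^log) = ℤ/lℤ ⋊ {±1}`;
`Aut_K(C̲̲^log) = μ_l`; `Aut_K(C̲^log) = {1}`" (printed order: double underline first, as in Prop 2.4;
kurims render p.35 distinguishes the decorations) — as abstract groups (`μ_l ≅ ℤ/lℤ`; `ℤ/lℤ ⋊ {±1}`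
with the inversion action = the dihedral group of order `2l`), via `autK`.
[cite: MochizukiEtTh2009, Rmk 2.6.1 p.40] -/
def Rmk261 [NeZero l] : Prop :=
  T.HasMuL →
  Nonempty (T.autK (T.tp T.PiXuu) ≃* Multiplicative (ZMod l) × Multiplicative (ZMod 2)) ∧
  Nonempty (T.autK (T.tp T.PiXu) ≃* DihedralGroup l) ∧
  Nonempty (T.autK (T.tp T.PiCuu) ≃* Multiplicative (ZMod l)) ∧
  Subsingleton (T.autK (T.tp T.PiCu))

/-- **Remark 2.6.1**, dotted versions: "given by taking the direct product of the `Aut_K(−)`'s listed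
above with `Gal(Ċ^log/C^log) ≅ {±1}`". [cite: MochizukiEtTh2009, Rmk 2.6.1 p.40] -/
def Rmk261_dotted [NeZero l] : Prop :=
  T.HasMuL →
  Nonempty (T.autK (T.tp T.PiXuu ⊓ T.PiCdot) ≃*
    (Multiplicative (ZMod l) × Multiplicative (ZMod 2)) × Multiplicative (ZMod 2)) ∧
  Nonempty (T.autK (T.tp T.PiXu ⊓ T.PiCdot) ≃* DihedralGroup l × Multiplicative (ZMod 2)) ∧
  Nonempty (T.autK (T.tp T.PiCuu ⊓ T.PiCdot) ≃* Multiplicative (ZMod l) × Multiplicative (ZMod 2)) ∧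
  Nonempty (T.autK (T.tp T.PiCu ⊓ T.PiCdot) ≃* Multiplicative (ZMod 2))

/-! ## Corollary 2.9 (labels of cusps) -/

/-- The decomposition group in `Π^tp_C` of the unique cusp of `C` is not part of the interface; the
`Aut_K(Z)`-orbits of cusps of a member `Z` are the double cosets
`N_{Π^tp_C}(Π^tp_Z) \ Π^tp_C / D`, `D` = the stabiliser of a cusp of `C`; we use `D_x ⊆ Π_X` pulled
back to `Π^tp_C` and enlarged by the normaliser in `Π^tp_C` (index `2`: the inversion fixes `x`).
[cite: MochizukiEtTh2009, Cor 2.9 p.43] -/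
def cuspStabC : Subgroup T.Gtp := Subgroup.normalizer ((T.tp T.Dx : Subgroup T.Gtp) : Set T.Gtp)

/-- The set of `Aut_K(Z)`-orbits of cusps of the member `Z` with `Π^tp_Z = S`: double cosets
`N(S) \ Π^tp_C / cuspStabC`. [cite: MochizukiEtTh2009, Cor 2.9 p.43] -/
abbrev cuspOrbits (S : Subgroup T.Gtp) : Type u :=
  DoubleCoset.Quotient (Subgroup.normalizer (S : Set T.Gtp) : Set T.Gtp) (T.cuspStabC : Set T.Gtp)

/-- **Corollary 2.9** (Labels of Cusps; `K ⊇ μ_l`): for each of `Ẋ̲̲, Ċ̲, Ċ̲̲, X̲̲, C̲, C̲̲` the labels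
`∈ (ℤ/lℤ)^±` are in bijection with the `Aut_K(−)`-orbits of cusps — typed as the CARDINALITY
statement `#orbits = #(ℤ/lℤ)^± = (l+1)/2` (`l` odd); the label map itself (p.42) is
TODO-merge(abc-iut-L2-t1/L3-t2). [cite: MochizukiEtTh2009, Cor 2.9 p.43] -/
def Cor29_card : Prop :=
  T.HasMuL → ∀ S ∈ [T.tp T.PiXuu ⊓ T.PiCdot, T.tp T.PiCu ⊓ T.PiCdot, T.tp T.PiCuu ⊓ T.PiCdot,
      T.tp T.PiXuu, T.tp T.PiCu, T.tp T.PiCuu],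
    Nat.card (T.cuspOrbits S) = (l + 1) / 2

/-- **Corollary 2.9, last sentence**: for `X̲̲, C̲, C̲̲` "these bijections are preserved by arbitrary
isomorphisms `γ` as in Corollary 2.8" — typed: the extension `Γ` to `Π^tp_C` (stabilising the Prop 2.4
list of the curve and the cusp stabiliser, so that it acts on the orbit space) acts TRIVIALLY on the
orbit space of cusps. [cite: MochizukiEtTh2009, Cor 2.9 p.43] -/
def Cor29_preserved : Prop :=
  T.HasMuL → ∀ p ∈ [(T.tp T.PiXuu, T.tower), (T.tp T.PiCu, [T.tp T.PiCu, T.tp T.PiXu, T.tp T.PiX,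
      T.PiYddtp]), (T.tp T.PiCuu, T.tower)], ∀ Γ : T.Gtp ≃ₜ* T.Gtp,
    (∀ S' ∈ p.2, S'.map Γ.toMulEquiv.toMonoidHom = S') →
    T.cuspStabC.map Γ.toMulEquiv.toMonoidHom = T.cuspStabC →
    ∀ g : T.Gtp, DoubleCoset.mk (Subgroup.normalizer (p.1 : Set T.Gtp)) T.cuspStabC (Γ g) =
      DoubleCoset.mk (Subgroup.normalizer (p.1 : Set T.Gtp)) T.cuspStabC g

/-! ### Remark 2.9.1 (p.43): "a bijection as in Corollary 2.9 fails to hold for `Ẋ̲^log`, `X̲^log`"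
[cf. Rmk 2.6.1: the extra `μ_l` of automorphisms]. Typed as the negation of the cardinality
statement for these two members. -/

/-- **Remark 2.9.1**, CARDINALITY FORM (strictly stronger than the printed "a bijection as in Corollary 2.9
fails to hold for `Ẋ̲`, `X̲`", and what Rmk 2.6.1 actually gives): `Gal(X̲/X) ≅ ℤ/lℤ ⊆ Aut_K(X̲)` permutes the
`l` cusps over `x` transitively (for `Ẋ̲` also `Gal(Ċ/C)` swaps the sheets), so there is exactly ONE
`Aut_K`-orbit of cusps — whereas `#(ℤ/lℤ)^± = (l+1)/2 > 1` for `l > 1`. [cite: MochizukiEtTh2009, Rmk 2.9.1 p.43] -/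
def Rmk291_card : Prop :=
  T.HasMuL → ∀ S ∈ [T.tp T.PiXu ⊓ T.PiCdot, T.tp T.PiXu], Nat.card (T.cuspOrbits S) = 1

/-! ## Definition 2.7 (p.41) — DEFERRED: "If `η̈^{Θ,ℤ}` is of standard type, then we shall also refer
to `η̈^{Θ,l·ℤ}`, `η̲̈^{Θ,l·ℤ}`, `η̈^{Θ,l·ℤ×μ₂}`, `η̲̈^{Θ,l·ℤ×μ₂}`, `η̈^{Θ,ℤ×μ₂}` as being of standard type"
— a definitional transfer of abc-iut-L2-t1's Def 1.9 (ii) predicate to the derived orbits; typed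
together with those orbits against t1's decls (no free `Prop` stub here). -/

/-! ### Not typed in this file: the constructions of p.40–41 (the `l`-th roots `η̲̈^Θ ∈
H¹(Π^tp_{Ÿ̲̲}, l·Δ_Θ)` of the étale theta class and the five orbits of Def 2.7 as DATA), Cor 2.8
(i)–(iii) (constant multiple rigidity of roots; (ii) needs the `μ_N`-structures on
`(K^×)^∧`-torsors at cusps of [GalSect] = [Mzk13] Cor 4.12 and the canonical integral structure,
Def 4.1 (iii) loc. cit.) and Rmk 2.9.2 — they quantify over §1 objects (`η̈^Θ`, Def 1.9, Thm 1.10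
(iii)) owned by abc-iut-L2-t1 and, for Cor 2.8 (i), over underline-decorated orbit symbols that
the text render does not distinguish; to be typed against t1's `EtaleThetaClass` decls and the
page image (HANDOFF of seat abc-iut-L2-t2). -/

/-! ## Lemma 2.17 and Remark 2.16.2 (discrete normalisers) -/

/-- **Lemma 2.17 (i)** (Discrete Normalizers): `G ◁ F` of finite index, `G` free of finite rank,
`H ⊆ F` with `H ∩ G` nonabelian, `F̂` the profinite completion (Mathlib `ProfiniteGrp`): "Then
`N_{F̂}(H) = N_F(H)`". (Proof via Stebe's conjugacy separability, [LynSch] Prop 4.9 — not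
formalised.) [cite: MochizukiEtTh2009, Lem 2.17(i) p.58] -/
def Lem217_i : Prop :=
  ∀ (F : Type u) [Group F] (G H : Subgroup F) [IsFreeGroup G], G.Normal → G.FiniteIndex →
    Finite (IsFreeGroup.Generators G) → (∃ a ∈ H ⊓ G, ∃ b ∈ H ⊓ G, a * b ≠ b * a) →
    let η : F →* ProfiniteGrp.ProfiniteCompletion.completion (GrpCat.of F) :=
      (ProfiniteGrp.ProfiniteCompletion.eta (GrpCat.of F)).hom
    Subgroup.normalizer ((H.map η : Subgroup _) : Set _) =
      (Subgroup.normalizer (H : Set F)).map η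


/-- **Lemma 2.17 (ii)** (Discrete Normalizers): for `Π` the tempered fundamental group of a
hyperbolic orbicurve over a finite extension of `ℚ_p` (here: any member of the tower, inside
`Π^tp_C`) and `H ⊆ Π` an open subgroup, `N_{Π̂}(H) = N_Π(H)` — the normaliser of (the image of) `H`
in the profinite completion is (the image of) the normaliser in `Π`. Typed for `Π = Π^tp_C ↪ Π_C` —
an INSTANCE of Lem 2.17 (ii) for the `K`-core `C`; the general form (any hyperbolic orbicurve) is not
typed here. [cite: MochizukiEtTh2009, Lem 2.17(ii) p.58] -/
def Lem217_ii : Prop :=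
  ∀ H : Subgroup T.Gtp, IsOpen (H : Set T.Gtp) →
    Subgroup.normalizer ((H.map T.toHat : Subgroup T.PiC) : Set T.PiC) =
      (Subgroup.normalizer (H : Set T.Gtp)).map T.toHat

/-! ### Remark 2.16.2 (p.57), mathematical content — NOT typed as a named fact: "we have
`N_{Π^tp_X}(H) = N_{Π_{X_F}}(Im(H))` [by Lemma 2.17, (ii); the well-known fact that `G_{F_v}` is its own
normalizer in `G_F`]" for the NATURAL map `Π^tp_X → Π_X = Π_{X_F} ×_{G_F} G_{F_v} → Π_{X_F}`. Its content is
`Lem217_ii` plus the arithmetic input (commensurable terminality of `G_{F_v} ⊆ G_F`, [Mzk2] Thm 1.1.1)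
and the fibre-product description of `Π_X`, none of which is in this file's scope; an abstract-`φ`
version with weaker antecedents is FALSE (review of p406455: `V₄ ◁ D₄ ≤ S₄`). Recorded as documentation. -/

/-! ### Remark 2.16.3 (p.58): the equality of normalisers of Rmk 2.16.2 "may be thought of as a
sort of group-theoretic version of the condition that the map from a finite prime of a number
field to the global number field be unramified" — commentary, no decl. -/

end TemperedCoverData

end ThetaCovers

end Literature.AnabelianGeometry.EtaleTheta
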